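import Literature.MathematicalPhysics.QuantumManyBody.JelliumBoseGasProofs
import Mathlib.MeasureTheory.Measure.Haar.NormedSpace
import HarnessLib

/-!
# Dilation covariance of the (charged) Bose gas and reduction of Foldy's law to unit coupling

Topic `Literature/MathematicalPhysics/QuantumManyBody`, second companion of `JelliumBoseGas.lean`
(provefact `Literature.MathematicalPhysics.QuantumManyBody.JelliumBoseGas.foldyLaw`,
[LSSY2005, Thm. 10.1]); continues `JelliumBoseGasProofs.lean`.

The units dictionary in the docstring of `foldyLaw` ("`-∑Δᵢ + qU = q · H_LSSY(μ = 1/q)`, hence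
`-foldyConstant · q^{5/4} ρ^{1/4}`") is made rigorous INSIDE the tree's variational vocabulary by
the exact dilation symmetry of the problem, and `foldyLaw` is thereby reduced to its
unit-coupling instance, which is [LSSY2005, Thm. 10.1 (10.2)] at `μ = 1` verbatim.

* `BoseGas.lintegral_comp_smul_addHaar` — `∫⁻ f(r x) dμ = |r^{-dim}| ∫⁻ f dμ` for an additive
  Haar measure (the `ℝ≥0∞` form of Mathlib's `Measure.integral_comp_smul`; the tree's
  `BoseGas.lintegral_comp_smul` of `PeriodicBoseGasFourier.lean` is its special case on `ℝ³`).
* `BoseGas.scalePotential s v = (r ↦ s⁻² v(r/s))` and `BoseGas.TrialState.dilate`: for `s > 0`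
  the dilation `Ψ_s(Y) = s^{-dim/2} Ψ(s⁻¹ Y)` is an admissible trial state of `Λ_{sL}`
  (Dirichlet condition, Bose symmetry, `C¹` and normalisation transported; `dim = 3N` enters
  only through Mathlib's `finrank`).
* `BoseGas.kineticDensity_comp_smul`, `interaction_scalePotential`, `TrialState.energy_dilate` —
  `𝓔_{v_s}[Ψ_s] = s⁻² 𝓔_v[Ψ]` (chain rule + Haar scaling).
* `JelliumBoseGas.backgroundPotential_smul` (`V₁^{sL}(x) = s² V₁^{L}(x/s)`),
  `jelliumInteraction_smul` (`jel_{ρ_b/s³, sL}(Y) = s⁻¹ jel_{ρ_b, L}(Y/s)` for EVERY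
  configuration — the tree's shift `6π ρ_b L²` per particle is dilation-covariant too),
  `lintegral_jellium_dilate`, `chargedEnergy_dilate`, and the covariance of the infimum
  **`chargedGroundStateEnergy_dilate`:
  `E₀[v_s, q/s, ρ_b/s³](N, sL) = s⁻² · E₀[v, q, ρ_b](N, L)`** (`≤` by dilating, `≥` by dilating
  back with `s⁻¹`); `backgroundSelfEnergy_smul`, `jelliumEnergyShift_smul` for the constants.
* `JelliumBoseGas.chargedGroundStateEnergy_coupling` / `jelliumEnergyShift_coupling`
  (`s = q⁻¹`, `v = 0`): `E₀[q, ρ](N, L_ρ) = q² E₀[1, ρ/q³](N, L_{ρ/q³})`, `L_{ρ/q³} = q L_ρ`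
  (`sideLength_div_pow_three`).
* `JelliumBoseGas.foldyLaw_iff_one` — **`foldyLaw ↔` its case `q = 1`** (with
  `q² (ρ/q³)^{1/4} = q^{5/4} ρ^{1/4}`). Combined with `foldyLaw_iff_bounds`
  (`JelliumBoseGasProofs.lean`), what remains for `foldyLaw_holds` is the pair of finite-volume
  bounds at unit coupling: the Lieb–Solovej lower bound and Solovej's upper bound.

## References

* [LSSY2005] E. H. Lieb, R. Seiringer, J. P. Solovej, J. Yngvason, *The Mathematics of the Bose
  Gas and its Condensation*, Birkhäuser 2005 (arXiv:cond-mat/0610117): Ch. 10 (arXiv Ch. 12),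
  (10.1), Thm. 10.1 with (10.2); §1.2.
* [LiebSolovej2001] E. H. Lieb, J. P. Solovej, Commun. Math. Phys. 217 (2001) 127–163, §2
  (scaling `ρ ↦ 1`); Errata 225 (2002) 219–221.
* [Solovej2006] J. P. Solovej, Commun. Math. Phys. 266 (2006) 797–818.
-/

noncomputable section

open MeasureTheory Filter Metric Set
open scoped ENNReal NNReal Topology Pointwise

namespace Literature.MathematicalPhysics.QuantumManyBody.BoseGas

variable {N : ℕ}

/-! ### Haar scaling of lower integrals -/

/-- `∫ f(r • x) dμ = |r^{-dim}| ∫ f dμ` for an additive Haar measure, `ℝ≥0∞` form of Mathlib's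
`Measure.integral_comp_smul`. [folklore] -/
theorem lintegral_comp_smul_addHaar {E : Type*} [NormedAddCommGroup E] [NormedSpace ℝ E]
    [MeasurableSpace E] [BorelSpace E] [FiniteDimensional ℝ E] (μ : Measure E)
    [μ.IsAddHaarMeasure] (f : E → ℝ≥0∞) {r : ℝ} (hr : r ≠ 0) :
    ∫⁻ x, f (r • x) ∂μ = ENNReal.ofReal |(r ^ Module.finrank ℝ E)⁻¹| * ∫⁻ x, f x ∂μ := by
  calc ∫⁻ x, f (r • x) ∂μ = ∫⁻ y, f y ∂(Measure.map (r • ·) μ) :=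
        (lintegral_map_equiv f
          (Homeomorph.smul (isUnit_iff_ne_zero.2 hr).unit).toMeasurableEquiv).symm
    _ = ENNReal.ofReal |(r ^ Module.finrank ℝ E)⁻¹| * ∫⁻ x, f x ∂μ := by
        rw [Measure.map_addHaar_smul μ hr, lintegral_smul_measure, smul_eq_mul]

/-! ### Scaled pair potentials and dilated trial states -/

/-- The pair potential seen after dilating space by `s`: `v_s(r) = s⁻² v(r/s)` (the Schrödinger
scaling `-Δ + v ↦ s⁻² (-Δ + s² v(s ·))` read backwards). [folklore] -/
def scalePotential (s : ℝ) (v : ℝ → ℝ≥0∞) : ℝ → ℝ≥0∞ :=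
  fun r => ENNReal.ofReal (s ^ 2)⁻¹ * v (s⁻¹ * r)

/-- Unfolding `scalePotential`. [folklore] -/
@[simp] theorem scalePotential_apply (s : ℝ) (v : ℝ → ℝ≥0∞) (r : ℝ) :
    scalePotential s v r = ENNReal.ofReal (s ^ 2)⁻¹ * v (s⁻¹ * r) := rfl

/-- Scaling the zero potential gives zero. [folklore] -/
@[simp] theorem scalePotential_zero (s : ℝ) : scalePotential s 0 = 0 := by
  funext r; simp

/-- Scaling by `s⁻¹` undoes scaling by `s` (`s ≠ 0`). [folklore] -/
theorem scalePotential_inv_scalePotential {s : ℝ} (hs : s ≠ 0) (v : ℝ → ℝ≥0∞) :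
    scalePotential s⁻¹ (scalePotential s v) = v := by
  funext r
  simp only [scalePotential_apply, inv_pow, inv_inv]
  rw [← mul_assoc, ← ENNReal.ofReal_mul (sq_nonneg s), mul_inv_cancel₀ (pow_ne_zero 2 hs),
    ENNReal.ofReal_one, one_mul, ← mul_assoc, inv_mul_cancel₀ hs, one_mul]

/-- Membership in the dilated box: `Y ∈ Λ_{sL}^N ↔ s⁻¹ Y ∈ Λ_L^N` (`s > 0`). [folklore] -/
theorem mem_boxN_smul_iff {s : ℝ} (hs : 0 < s) (L : ℝ) (Y : Config N) :
    Y ∈ boxN N (s * L) ↔ s⁻¹ • Y ∈ boxN N L := by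
  simp only [boxN, box, Set.mem_setOf_eq, Pi.smul_apply, PiLp.smul_apply, smul_eq_mul,
    Set.mem_Ioo]
  refine forall_congr' fun i => forall_congr' fun k => ?_
  rw [← div_eq_inv_mul, lt_div_iff₀ hs, div_lt_iff₀ hs, zero_mul, mul_comm L s]

/-- Membership in the dilated one-particle box. [folklore] -/
theorem mem_box_smul_iff {s : ℝ} (hs : 0 < s) (L : ℝ) (y : Space) :
    y ∈ box (s * L) ↔ s⁻¹ • y ∈ box L := by
  simp only [box, Set.mem_setOf_eq, PiLp.smul_apply, smul_eq_mul, Set.mem_Ioo]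
  refine forall_congr' fun k => ?_
  rw [← div_eq_inv_mul, lt_div_iff₀ hs, div_lt_iff₀ hs, zero_mul, mul_comm L s]

/-- The dilated one-particle box is the scaled set: `Λ_{sL} = s • Λ_L` (`s > 0`). [folklore] -/
theorem smul_box {s : ℝ} (hs : 0 < s) (L : ℝ) : s • box L = box (s * L) := by
  ext y
  rw [Set.mem_smul_set_iff_inv_smul_mem₀ hs.ne', mem_box_smul_iff hs]

/-- The normalisation constant of the dilation: `c_s² · |((s⁻¹)^{dim})⁻¹| = 1`. [folklore] -/
theorem dilate_const_mul {s : ℝ} (hs : 0 < s) (d : ℕ) :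
    ENNReal.ofReal ((Real.sqrt ((s ^ d)⁻¹)) ^ 2) * ENNReal.ofReal |((s⁻¹) ^ d)⁻¹| = 1 := by
  rw [Real.sq_sqrt (inv_nonneg.2 (pow_nonneg hs.le _)), inv_pow, inv_inv,
    abs_of_nonneg (pow_nonneg hs.le _), ← ENNReal.ofReal_mul (inv_nonneg.2 (pow_nonneg hs.le _)),
    inv_mul_cancel₀ (pow_ne_zero _ hs.ne'), ENNReal.ofReal_one]

/-- **Dilation of a trial state.** For `s > 0`, `Ψ ↦ Ψ_s`, `Ψ_s(Y) = s^{-dim/2} Ψ(s⁻¹ Y)`, maps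
the admissible trial states of the box `Λ_L` onto those of `Λ_{sL}` (`C¹`, Dirichlet, Bose
symmetry and normalisation are preserved; `dim = 3N`). [folklore] -/
def TrialState.dilate {L : ℝ} (Ψ : TrialState N L) {s : ℝ} (hs : 0 < s) :
    TrialState N (s * L) where
  ψ Y := (Real.sqrt ((s ^ Module.finrank ℝ (Config N))⁻¹) : ℂ) * Ψ.ψ (s⁻¹ • Y)
  contDiff := contDiff_const.mul (Ψ.contDiff.comp (contDiff_id.const_smul s⁻¹))
  eq_zero Y hY := by
    have h : s⁻¹ • Y ∉ boxN N L := fun h => hY ((mem_boxN_smul_iff hs L Y).2 h)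
    simp [Ψ.eq_zero _ h]
  symm σ Y := by
    show (Real.sqrt ((s ^ Module.finrank ℝ (Config N))⁻¹) : ℂ) * Ψ.ψ (s⁻¹ • (Y ∘ σ)) =
      (Real.sqrt ((s ^ Module.finrank ℝ (Config N))⁻¹) : ℂ) * Ψ.ψ (s⁻¹ • Y)
    rw [← Ψ.symm σ (s⁻¹ • Y)]
    rfl
  norm_eq := by
    simp only [ennorm_real_mul_sq _ (Real.sqrt_nonneg _)]
    rw [lintegral_const_mul' _ _ ENNReal.ofReal_ne_top,
      lintegral_comp_smul_addHaar volume (fun X => (‖Ψ.ψ X‖₊ : ℝ≥0∞) ^ 2) (inv_ne_zero hs.ne'),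
      ← mul_assoc, dilate_const_mul hs, one_mul, Ψ.norm_eq]

/-- The wave function of the dilated state. [folklore] -/
@[simp] theorem TrialState.dilate_ψ {L : ℝ} (Ψ : TrialState N L) {s : ℝ} (hs : 0 < s)
    (Y : Config N) :
    (Ψ.dilate hs).ψ Y = (Real.sqrt ((s ^ Module.finrank ℝ (Config N))⁻¹) : ℂ) * Ψ.ψ (s⁻¹ • Y) :=
  rfl

/-! ### Scaling of the kinetic and interaction energies -/

/-- Chain rule for the dilation: `|∇(Ψ ∘ s⁻¹)|²(Y) = s⁻² |∇Ψ|²(s⁻¹ Y)`. [folklore] -/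
theorem kineticDensity_comp_smul {ψ : Config N → ℂ} (hψ : ContDiff ℝ 1 ψ) {s : ℝ} (hs : 0 < s)
    (Y : Config N) :
    kineticDensity (fun Y => ψ (s⁻¹ • Y)) Y =
      ENNReal.ofReal (s ^ 2)⁻¹ * kineticDensity ψ (s⁻¹ • Y) := by
  have hd : HasFDerivAt (fun Y : Config N => ψ (s⁻¹ • Y))
      ((fderiv ℝ ψ (s⁻¹ • Y)).comp (s⁻¹ • ContinuousLinearMap.id ℝ (Config N))) Y := by
    have h1 : HasFDerivAt (fun Y : Config N => s⁻¹ • Y) (s⁻¹ • ContinuousLinearMap.id ℝ (Config N))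
        Y := (hasFDerivAt_id Y).const_smul s⁻¹
    exact ((hψ.differentiable one_ne_zero) _).hasFDerivAt.comp Y h1
  unfold kineticDensity
  rw [hd.fderiv, Finset.mul_sum]
  refine Finset.sum_congr rfl fun i _ => ?_
  rw [Finset.mul_sum]
  refine Finset.sum_congr rfl fun k _ => ?_
  simp only [ContinuousLinearMap.comp_apply, FunLike.coe_smul, Pi.smul_apply,
    ContinuousLinearMap.coe_id', id_eq, ContinuousLinearMap.map_smul, nnnorm_smul,
    ENNReal.coe_mul, mul_pow]
  congr 1
  rw [← ENNReal.coe_pow, ← ENNReal.ofReal_coe_nnreal]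
  congr 1
  push_cast
  rw [norm_inv, Real.norm_of_nonneg hs.le, inv_pow]

/-- Distances scale: `dist (s⁻¹ Y i) (s⁻¹ Y j) = s⁻¹ dist (Y i) (Y j)` (`s > 0`). [folklore] -/
theorem dist_smul_inv_apply {s : ℝ} (hs : 0 < s) (Y : Config N) (i j : Fin N) :
    dist ((s⁻¹ • Y) i) ((s⁻¹ • Y) j) = s⁻¹ * dist (Y i) (Y j) := by
  rw [Pi.smul_apply, Pi.smul_apply, dist_smul₀, Real.norm_of_nonneg (inv_nonneg.2 hs.le)]

/-- The interaction of the scaled potential on the dilated configuration. [folklore] -/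
theorem interaction_scalePotential {s : ℝ} (hs : 0 < s) (v : ℝ → ℝ≥0∞) (Y : Config N) :
    interaction (scalePotential s v) Y = ENNReal.ofReal (s ^ 2)⁻¹ * interaction v (s⁻¹ • Y) := by
  unfold interaction
  rw [Finset.mul_sum]
  refine Finset.sum_congr rfl fun i _ => ?_
  rw [Finset.mul_sum]
  refine Finset.sum_congr rfl fun j _ => ?_
  rw [scalePotential_apply, dist_smul_inv_apply hs]

/-- **Energy scaling.** `𝓔_{v_s}[Ψ_s] = s⁻² 𝓔_v[Ψ]` for the dilated state in the dilated box with
the scaled potential. [folklore] -/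
theorem TrialState.energy_dilate {L : ℝ} (v : ℝ → ℝ≥0∞) (Ψ : TrialState N L) {s : ℝ}
    (hs : 0 < s) :
    energy (scalePotential s v) (Ψ.dilate hs) = ENNReal.ofReal (s ^ 2)⁻¹ * energy v Ψ := by
  set c : ℝ := Real.sqrt ((s ^ Module.finrank ℝ (Config N))⁻¹) with hc
  have hc0 : 0 ≤ c := Real.sqrt_nonneg _
  have hφ : ContDiff ℝ 1 (fun Y : Config N => Ψ.ψ (s⁻¹ • Y)) :=
    Ψ.contDiff.comp (contDiff_id.const_smul s⁻¹)
  unfold energy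
  have hpt : ∀ Y, kineticDensity (Ψ.dilate hs).ψ Y +
      interaction (scalePotential s v) Y * (‖(Ψ.dilate hs).ψ Y‖₊ : ℝ≥0∞) ^ 2 =
      ENNReal.ofReal (c ^ 2) * (ENNReal.ofReal (s ^ 2)⁻¹ *
        (fun X => kineticDensity Ψ.ψ X + interaction v X * (‖Ψ.ψ X‖₊ : ℝ≥0∞) ^ 2)
          (s⁻¹ • Y)) := by
    intro Y
    have h1 : kineticDensity (Ψ.dilate hs).ψ Y =
        ENNReal.ofReal (c ^ 2) * (ENNReal.ofReal (s ^ 2)⁻¹ * kineticDensity Ψ.ψ (s⁻¹ • Y)) := by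
      change kineticDensity (fun Y => (c : ℂ) * Ψ.ψ (s⁻¹ • Y)) Y = _
      rw [kineticDensity_const_mul hφ c hc0, kineticDensity_comp_smul Ψ.contDiff hs]
    rw [h1, TrialState.dilate_ψ, ennorm_real_mul_sq _ hc0, interaction_scalePotential hs]
    ring
  simp_rw [hpt]
  rw [lintegral_const_mul' _ _ ENNReal.ofReal_ne_top, lintegral_const_mul' _ _ ENNReal.ofReal_ne_top,
    lintegral_comp_smul_addHaar volume
      (fun X => kineticDensity Ψ.ψ X + interaction v X * (‖Ψ.ψ X‖₊ : ℝ≥0∞) ^ 2)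
      (inv_ne_zero hs.ne')]
  rw [← mul_assoc, ← mul_assoc, mul_comm (ENNReal.ofReal (c ^ 2)), mul_assoc, mul_assoc,
    ← mul_assoc (ENNReal.ofReal (c ^ 2)), hc, dilate_const_mul hs, one_mul]

end Literature.MathematicalPhysics.QuantumManyBody.BoseGas

namespace Literature.MathematicalPhysics.QuantumManyBody.JelliumBoseGas

open BoseGas

variable {N : ℕ}

/-! ### Scaling of the jellium terms -/

/-- **Scaling of the background potential**: `V₁^{sL}(x) = s² V₁^{L}(s⁻¹ x)` (`s > 0`), by the
substitution `y = s y'` in `∫_{Λ_{sL}} |x - y|⁻¹ dy`. [cite: LSSY2005, Ch. 10 (10.1)] -/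
theorem backgroundPotential_smul {s : ℝ} (hs : 0 < s) (L : ℝ) (x : Space) :
    backgroundPotential (s * L) x = s ^ 2 * backgroundPotential L (s⁻¹ • x) := by
  unfold backgroundPotential
  have h := Measure.setIntegral_comp_smul_of_pos (volume : Measure Space)
    (fun y : Space => ‖x - y‖⁻¹) (box L) hs
  rw [smul_box hs, finrank_euclideanSpace_fin] at h
  have h2 : ∀ y : Space, ‖x - s • y‖⁻¹ = s⁻¹ * ‖s⁻¹ • x - y‖⁻¹ := by
    intro y
    have : x - s • y = s • (s⁻¹ • x - y) := by
      rw [smul_sub, smul_inv_smul₀ hs.ne']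
    rw [this, norm_smul, Real.norm_of_nonneg hs.le, mul_inv]
  simp_rw [h2] at h
  rw [integral_const_mul, smul_eq_mul] at h
  have hs3 : (s ^ 3)⁻¹ ≠ 0 := inv_ne_zero (pow_ne_zero 3 hs.ne')
  calc ∫ y in box (s * L), ‖x - y‖⁻¹
      = s ^ 3 * (s⁻¹ * ∫ y in box L, ‖s⁻¹ • x - y‖⁻¹) := by
        rw [h, ← mul_assoc, mul_inv_cancel₀ (pow_ne_zero 3 hs.ne'), one_mul]
    _ = s ^ 2 * ∫ y in box L, ‖s⁻¹ • x - y‖⁻¹ := by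
        field_simp

/-- **Scaling of the jellium energy**: with background density `ρ_b/s³` in the box `Λ_{sL}`,
`jel(Y) = s⁻¹ · jel_{ρ_b, L}(s⁻¹ Y)` for every configuration `Y` (`s > 0`) — the Coulomb
energy is homogeneous of degree `-1`, and the shift `6π (ρ_b/s³) (sL)²` scales the same way.
[cite: LSSY2005, Ch. 10 (10.1)] -/
theorem jelliumInteraction_smul {s : ℝ} (hs : 0 < s) (ρb L : ℝ) (Y : Config N) :
    jelliumInteraction (ρb / s ^ 3) N (s * L) Y =
      ENNReal.ofReal s⁻¹ * jelliumInteraction ρb N L (s⁻¹ • Y) := by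
  rw [jelliumInteraction_eq, jelliumInteraction_eq, mul_add, Finset.mul_sum, Finset.mul_sum]
  congr 1
  · refine Finset.sum_congr rfl fun i _ => ?_
    rw [Finset.mul_sum]
    refine Finset.sum_congr rfl fun j _ => ?_
    rw [Pi.smul_apply, Pi.smul_apply, ← smul_sub, norm_smul, Real.norm_of_nonneg
      (inv_nonneg.2 hs.le), mul_inv, inv_inv, ← ENNReal.ofReal_mul (inv_nonneg.2 hs.le),
      ← mul_assoc, inv_mul_cancel₀ hs.ne', one_mul]
  · refine Finset.sum_congr rfl fun i _ => ?_
    rw [Pi.smul_apply, backgroundPotential_smul hs, ← ENNReal.ofReal_mul (inv_nonneg.2 hs.le)]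
    congr 1
    field_simp

/-- The jellium expectation of the dilated state: `⟨Ψ_s, jel' Ψ_s⟩ = s⁻¹ ⟨Ψ, jel Ψ⟩`.
[cite: LSSY2005, Ch. 10 (10.1)] -/
theorem lintegral_jellium_dilate {L : ℝ} (Ψ : TrialState N L) {s : ℝ} (hs : 0 < s)
    (ρb : ℝ) :
    ∫⁻ Y, jelliumInteraction (ρb / s ^ 3) N (s * L) Y * (‖(Ψ.dilate hs).ψ Y‖₊ : ℝ≥0∞) ^ 2 =
      ENNReal.ofReal s⁻¹ * ∫⁻ X, jelliumInteraction ρb N L X * (‖Ψ.ψ X‖₊ : ℝ≥0∞) ^ 2 := by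
  set c : ℝ := Real.sqrt ((s ^ Module.finrank ℝ (Config N))⁻¹) with hc
  have hc0 : 0 ≤ c := Real.sqrt_nonneg _
  have hpt : ∀ Y, jelliumInteraction (ρb / s ^ 3) N (s * L) Y *
      (‖(Ψ.dilate hs).ψ Y‖₊ : ℝ≥0∞) ^ 2 =
      ENNReal.ofReal (c ^ 2) * (ENNReal.ofReal s⁻¹ *
        (fun X => jelliumInteraction ρb N L X * (‖Ψ.ψ X‖₊ : ℝ≥0∞) ^ 2) (s⁻¹ • Y)) := by
    intro Y
    rw [TrialState.dilate_ψ, ennorm_real_mul_sq _ hc0, jelliumInteraction_smul hs]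
    ring
  simp_rw [hpt]
  rw [lintegral_const_mul' _ _ ENNReal.ofReal_ne_top, lintegral_const_mul' _ _ ENNReal.ofReal_ne_top,
    lintegral_comp_smul_addHaar volume
      (fun X => jelliumInteraction ρb N L X * (‖Ψ.ψ X‖₊ : ℝ≥0∞) ^ 2) (inv_ne_zero hs.ne'),
    ← mul_assoc, ← mul_assoc, mul_comm (ENNReal.ofReal (c ^ 2)), mul_assoc, mul_assoc,
    ← mul_assoc (ENNReal.ofReal (c ^ 2)), hc, dilate_const_mul hs, one_mul]

/-- **Scaling of the charged energy**: `cE_{v_s, q/s, ρ_b/s³}[Ψ_s] = s⁻² cE_{v, q, ρ_b}[Ψ]`.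
[cite: LSSY2005, Ch. 10 (10.1)] -/
theorem chargedEnergy_dilate {L : ℝ} (v : ℝ → ℝ≥0∞) (q ρb : ℝ) (Ψ : TrialState N L)
    {s : ℝ} (hs : 0 < s) :
    chargedEnergy (scalePotential s v) (q / s) (ρb / s ^ 3) (Ψ.dilate hs) =
      ENNReal.ofReal (s ^ 2)⁻¹ * chargedEnergy v q ρb Ψ := by
  unfold chargedEnergy
  rw [Ψ.energy_dilate v hs, lintegral_jellium_dilate Ψ hs ρb, div_eq_mul_inv,
    ENNReal.ofReal_mul' (inv_nonneg.2 hs.le), mul_add]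
  have : ENNReal.ofReal s⁻¹ * ENNReal.ofReal s⁻¹ = ENNReal.ofReal (s ^ 2)⁻¹ := by
    rw [← ENNReal.ofReal_mul (inv_nonneg.2 hs.le), ← mul_inv, sq]
  rw [← this]
  ring

/-- **Dilation covariance of the charged ground-state energy.** For `s > 0`,
`E₀[v_s, q/s, ρ_b/s³](N, sL) = s⁻² E₀[v, q, ρ_b](N, L)`: dilation is a bijection between the
trial states of `Λ_L` and of `Λ_{sL}` scaling every term of the charged energy by `s⁻²`. In
particular (with `v = 0`) coupling `q` at background density `ρ` is coupling `1` at density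
`ρ/q³`, lengths stretched by `q`, energies multiplied by `q²`. [cite: LSSY2005, Ch. 10 (10.1)] -/
theorem chargedGroundStateEnergy_dilate (v : ℝ → ℝ≥0∞) (q ρb : ℝ) (N : ℕ) (L : ℝ) {s : ℝ}
    (hs : 0 < s) :
    chargedGroundStateEnergy (scalePotential s v) (q / s) (ρb / s ^ 3) N (s * L) =
      ENNReal.ofReal (s ^ 2)⁻¹ * chargedGroundStateEnergy v q ρb N L := by
  -- `≤` from dilating by `s`
  have hle : ∀ (v : ℝ → ℝ≥0∞) (q ρb L : ℝ) {s : ℝ}, 0 < s →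
      chargedGroundStateEnergy (scalePotential s v) (q / s) (ρb / s ^ 3) N (s * L) ≤
        ENNReal.ofReal (s ^ 2)⁻¹ * chargedGroundStateEnergy v q ρb N L := by
    intro v q ρb L s hs
    have h0 : ENNReal.ofReal (s ^ 2)⁻¹ ≠ 0 := (ENNReal.ofReal_pos.2 (by positivity)).ne'
    unfold chargedGroundStateEnergy
    rw [ENNReal.mul_iInf_of_ne h0 ENNReal.ofReal_ne_top]
    refine le_iInf fun Ψ => ?_
    rw [← chargedEnergy_dilate v q ρb Ψ hs]
    exact iInf_le _ _
  refine le_antisymm (hle v q ρb L hs) ?_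
  -- `≥` from dilating back by `s⁻¹`
  have h := hle (scalePotential s v) (q / s) (ρb / s ^ 3) (s * L) (inv_pos.2 hs)
  rw [scalePotential_inv_scalePotential hs.ne', inv_pow, inv_pow, inv_inv, inv_mul_cancel_left₀ hs.ne',
    show q / s / s⁻¹ = q by field_simp, show ρb / s ^ 3 / (s ^ 3)⁻¹ = ρb by field_simp] at h
  calc ENNReal.ofReal (s ^ 2)⁻¹ * chargedGroundStateEnergy v q ρb N L
      ≤ ENNReal.ofReal (s ^ 2)⁻¹ * (ENNReal.ofReal (s ^ 2) *
          chargedGroundStateEnergy (scalePotential s v) (q / s) (ρb / s ^ 3) N (s * L)) :=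
        mul_le_mul_of_nonneg_left h bot_le
    _ = chargedGroundStateEnergy (scalePotential s v) (q / s) (ρb / s ^ 3) N (s * L) := by
        rw [← mul_assoc, ← ENNReal.ofReal_mul (by positivity), inv_mul_cancel₀ (by positivity),
          ENNReal.ofReal_one, one_mul]

/-- **Scaling of the background self-energy**: `C(ρ_b/s³, sL) = s⁻¹ C(ρ_b, L)` (`s > 0`).
[cite: LSSY2005, Ch. 10 (10.1)] -/
theorem backgroundSelfEnergy_smul {s : ℝ} (hs : 0 < s) (ρb L : ℝ) :
    backgroundSelfEnergy (ρb / s ^ 3) (s * L) = s⁻¹ * backgroundSelfEnergy ρb L := by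
  unfold backgroundSelfEnergy
  have h := Measure.setIntegral_comp_smul_of_pos (volume : Measure Space)
    (fun x : Space => backgroundPotential (s * L) x) (box L) hs
  rw [smul_box hs, finrank_euclideanSpace_fin] at h
  simp_rw [backgroundPotential_smul hs L, inv_smul_smul₀ hs.ne'] at h
  rw [integral_const_mul, smul_eq_mul] at h
  have hI : ∫ x in box (s * L), s ^ 2 * backgroundPotential L (s⁻¹ • x) =
      s ^ 3 * (s ^ 2 * ∫ x in box L, backgroundPotential L x) := by
    rw [h, ← mul_assoc, mul_inv_cancel₀ (pow_ne_zero 3 hs.ne'), one_mul]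
  simp_rw [backgroundPotential_smul hs L]
  rw [hI]
  field_simp

/-- **Scaling of the energy shift**: `shift(q/s, ρ_b/s³, N, sL) = s⁻² shift(q, ρ_b, N, L)`.
[cite: LSSY2005, Ch. 10 (10.1)] -/
theorem jelliumEnergyShift_smul {s : ℝ} (hs : 0 < s) (q ρb : ℝ) (N : ℕ) (L : ℝ) :
    jelliumEnergyShift (q / s) (ρb / s ^ 3) N (s * L) = (s ^ 2)⁻¹ * jelliumEnergyShift q ρb N L := by
  unfold jelliumEnergyShift
  rw [backgroundSelfEnergy_smul hs]
  field_simp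

end Literature.MathematicalPhysics.QuantumManyBody.JelliumBoseGas

namespace Literature.MathematicalPhysics.QuantumManyBody.JelliumBoseGas

open BoseGas

/-! ### Reduction of Foldy's law to unit coupling -/

/-- `L(ρ/q³, N) = q · L(ρ, N)`: stretching lengths by `q` divides the density by `q³`.
[cite: LSSY2005, §1.2] -/
theorem sideLength_div_pow_three {ρ q : ℝ} (hρ : 0 < ρ) (hq : 0 < q) (N : ℕ) :
    sideLength (ρ / q ^ 3) N = q * sideLength ρ N := by
  unfold sideLength
  rw [div_div_eq_mul_div, mul_comm (N : ℝ) (q ^ 3), mul_div_assoc,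
    Real.mul_rpow (pow_nonneg hq.le 3) (div_nonneg N.cast_nonneg hρ.le)]
  congr 1
  rw [← Real.rpow_natCast q 3, ← Real.rpow_mul hq.le]
  norm_num

/-- **Coupling `q` is coupling `1` at density `ρ/q³`, energies times `q²`** (dilation covariance
with `s = q⁻¹`, `v = 0`). [cite: LSSY2005, Ch. 10 (10.1)–(10.2)] -/
theorem chargedGroundStateEnergy_coupling {ρ q : ℝ} (hρ : 0 < ρ) (hq : 0 < q) (N : ℕ) :
    chargedGroundStateEnergy 0 q ρ N (sideLength ρ N) =
      ENNReal.ofReal (q ^ 2) *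
        chargedGroundStateEnergy 0 1 (ρ / q ^ 3) N (sideLength (ρ / q ^ 3) N) := by
  have h := chargedGroundStateEnergy_dilate 0 1 (ρ / q ^ 3) N (sideLength (ρ / q ^ 3) N)
    (inv_pos.2 hq)
  rw [scalePotential_zero, sideLength_div_pow_three hρ hq, inv_pow, inv_pow, inv_inv,
    inv_mul_cancel_left₀ hq.ne', one_div, inv_inv,
    show ρ / q ^ 3 / (q ^ 3)⁻¹ = ρ by field_simp] at h
  rw [sideLength_div_pow_three hρ hq, h]

/-- The same reduction for the energy shift (a real identity). [cite: LSSY2005, Ch. 10 (10.1)] -/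
theorem jelliumEnergyShift_coupling {ρ q : ℝ} (hρ : 0 < ρ) (hq : 0 < q) (N : ℕ) :
    jelliumEnergyShift q ρ N (sideLength ρ N) =
      q ^ 2 * jelliumEnergyShift 1 (ρ / q ^ 3) N (sideLength (ρ / q ^ 3) N) := by
  have h := jelliumEnergyShift_smul (inv_pos.2 hq) 1 (ρ / q ^ 3) N (sideLength (ρ / q ^ 3) N)
  rw [sideLength_div_pow_three hρ hq, inv_pow, inv_pow, inv_inv, inv_mul_cancel_left₀ hq.ne',
    one_div, inv_inv, show ρ / q ^ 3 / (q ^ 3)⁻¹ = ρ by field_simp] at h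
  rw [sideLength_div_pow_three hρ hq, h]

/-- **Foldy's law reduces to unit coupling.** `foldyLaw` (all couplings `q > 0`) is equivalent to
its instance `q = 1`, i.e. to [LSSY2005, Thm. 10.1] at `μ = 1` verbatim:
for every `ε > 0` there is `ρ₀` such that for `ρ ≥ ρ₀`, eventually in `N`,
`|E₀(N, L)/N + foldyConstant ρ^{1/4}| ≤ ε ρ^{1/4}` for the unit-charge jellium Hamiltonian
`-∑Δᵢ + U`. The passage to general `q` is the exact dilation covariance
`E₀[q, ρ] = q² E₀[1, ρ/q³]` (`chargedGroundStateEnergy_coupling`), under which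
`q² (ρ/q³)^{1/4} = q^{5/4} ρ^{1/4}` — the units dictionary of the docstring of `foldyLaw`, now
proved. [cite: LSSY2005, Thm. 10.1 (10.2)] -/
theorem foldyLaw_iff_one :
    foldyLaw ↔ ∀ ε : ℝ, 0 < ε → ∃ ρ₀ : ℝ, 0 < ρ₀ ∧ ∀ ρ : ℝ, ρ₀ ≤ ρ → ∀ᶠ N : ℕ in atTop,
      chargedGroundStateEnergy 0 1 ρ N (sideLength ρ N) ≠ ⊤ ∧
        |((chargedGroundStateEnergy 0 1 ρ N (sideLength ρ N)).toReal -
              jelliumEnergyShift 1 ρ N (sideLength ρ N)) / N +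
            foldyConstant * ρ ^ (1 / 4 : ℝ)| ≤ ε * ρ ^ (1 / 4 : ℝ) := by
  constructor
  · intro h ε hε
    obtain ⟨ρ₀, hρ₀, hρ⟩ := h 1 one_pos ε hε
    refine ⟨ρ₀, hρ₀, fun ρ hle => ?_⟩
    filter_upwards [hρ ρ hle] with N hN
    simpa only [Real.one_rpow, mul_one] using hN
  · intro h q hq ε hε
    have hq54 : 0 < q ^ (5 / 4 : ℝ) := Real.rpow_pos_of_pos hq _
    have hq34 : 0 < q ^ (3 / 4 : ℝ) := Real.rpow_pos_of_pos hq _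
    obtain ⟨ρ₁, hρ₁, h₁⟩ := h (ε / q ^ (5 / 4 : ℝ)) (div_pos hε hq54)
    refine ⟨q ^ 3 * ρ₁, by positivity, fun ρ hρ => ?_⟩
    have hρ0 : 0 < ρ := lt_of_lt_of_le (by positivity) hρ
    have hρ' : ρ₁ ≤ ρ / q ^ 3 := by rwa [le_div_iff₀ (by positivity), mul_comm]
    filter_upwards [h₁ (ρ / q ^ 3) hρ'] with N hN
    obtain ⟨hfin, hb⟩ := hN
    rw [chargedGroundStateEnergy_coupling hρ0 hq, jelliumEnergyShift_coupling hρ0 hq]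
    refine ⟨ENNReal.mul_ne_top ENNReal.ofReal_ne_top hfin, ?_⟩
    rw [ENNReal.toReal_mul, ENNReal.toReal_ofReal (sq_nonneg q), ← mul_sub, mul_div_assoc]
    set a : ℝ := ((chargedGroundStateEnergy 0 1 (ρ / q ^ 3) N (sideLength (ρ / q ^ 3) N)).toReal -
      jelliumEnergyShift 1 (ρ / q ^ 3) N (sideLength (ρ / q ^ 3) N)) / N with ha
    have hr : (ρ / q ^ 3) ^ (1 / 4 : ℝ) = ρ ^ (1 / 4 : ℝ) / q ^ (3 / 4 : ℝ) := by
      rw [Real.div_rpow hρ0.le (pow_nonneg hq.le 3), ← Real.rpow_natCast q 3,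
        ← Real.rpow_mul hq.le]
      norm_num
    have hq2 : q ^ 2 = q ^ (5 / 4 : ℝ) * q ^ (3 / 4 : ℝ) := by
      rw [← Real.rpow_add hq, ← Real.rpow_natCast q 2]
      norm_num
    have key : q ^ 2 * a + foldyConstant * q ^ (5 / 4 : ℝ) * ρ ^ (1 / 4 : ℝ) =
        q ^ 2 * (a + foldyConstant * (ρ / q ^ 3) ^ (1 / 4 : ℝ)) := by
      rw [hr, mul_add, hq2]
      field_simp
    rw [key, abs_mul, abs_of_pos (by positivity)]
    calc q ^ 2 * |a + foldyConstant * (ρ / q ^ 3) ^ (1 / 4 : ℝ)|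
        ≤ q ^ 2 * (ε / q ^ (5 / 4 : ℝ) * (ρ / q ^ 3) ^ (1 / 4 : ℝ)) :=
          mul_le_mul_of_nonneg_left hb (sq_nonneg q)
      _ = ε * ρ ^ (1 / 4 : ℝ) := by
          rw [hr, hq2]
          field_simp

end Literature.MathematicalPhysics.QuantumManyBody.JelliumBoseGas
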